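import Summits.Ventures.PercRepro.C041ZoneZPerZoneDict

/-!
# THE ZONE LEMMA OF THE TREE IS A THEOREM: `ZoneLemma a b c` from THEOREM Z′ (p6, gen 27; C-041.md §11–§12 — part 3)

Setting of `C041ZoneZPerZoneDict`, with the anchors `zoneA = Z ∩ K₀` and the protected anchors `zoneQ = {c} ∩ Z`.
For an admissible zone-state: `K` is `K_Z` (`zone_mem_K_iff`), «blue at `K`» is `BlueAtK` (`zone_blueK_iff`), «some anchor
deleted» is `AnchorDeleted` (`zone_anchorDel_iff`), `REACH` is `REACH_Z` (`zone_mem_REACH_iff`, through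
`mem_cluster_compl_iff_attached` on the admissible extension), «no red `2`-edge at `REACH`» is `NoRedTwoReach`
(`zone_reach2_iff`) and «not blue at `K`» is `ValidZone` (`zone_validZone_iff`).  Hence `toStZ` maps `𝓛_Z` of the tree
into `LsetF` and `ofStZ` maps `RsetF` into `𝓡_Z` of the tree, injectively (`card_Lset_le_card_LsetF`,
`card_RsetF_le_card_Rset`), and THEOREM Z′ (`card_LsetF_le_card_RsetF`) gives `#𝓛_Z ≤ #𝓡_Z` for every indexed zone:

* **`zoneLemma_holds`** — mine-3's ZONE LEMMA as named in `C041ZoneLemmaConj` (`ZoneLemma a b c`, declared there as a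
  conjecture, not asserted) is a theorem for every skeleton with `c` a non-terminal and distinct terminals;
* `INVConjTailFree_holds` — (INV) on the tail-free colourings a second way, through `INVConjTailFree_of_zoneLemma`.
-/

namespace PercRepro

namespace MultiGraph

open Finset ZoneZ ZoneZ.ZoneData

variable {V E : Type*} {G : MultiGraph V E} {a b c : V}

section Dict

variable [Fintype V] (hc : c ≠ a ∧ c ≠ b) (O : Config E) {Z : Finset V} (hZ : G.IsIdxZone a b c O Z)
  (x : G.ZoneState a b Z)

include hc hZ

omit [Fintype V] hc hZ in
/-- `K` with the anchors of the zone is `K_Z`. -/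
theorem zone_mem_K_iff (v : V) :
    v ∈ (G.zoneFZ a b O Z).K (G.zoneA a b c O Z) (G.toStZ a b Z x) ↔ G.KZone a b c O (G.extZone a b O Z x) Z v := by
  unfold ZoneData.K KZone
  rw [zone_mem_reach_red_iff O x]
  constructor
  · rintro ⟨s, ⟨hs, hsK⟩, h⟩
    exact ⟨s, hs, hsK, h⟩
  · rintro ⟨s, hs, hsK, h⟩
    exact ⟨s, ⟨hs, hsK⟩, h⟩

omit [Fintype V] hc hZ in
/-- A vertex of `K_Z` lies in `Z`. -/
theorem mem_of_kZone_ext {v : V} (h : G.KZone a b c O (G.extZone a b O Z x) Z v) : v ∈ Z := by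
  obtain ⟨w, hw, _, hwv⟩ := h
  exact mem_of_redIn_walk hw hwv

omit [Fintype V] hc hZ in
/-- A walk along a stronger relation is a walk along a weaker one. -/
theorem rtg_of_imp {r p : V → V → Prop} (h : ∀ u v, r u v → p u v) {u v : V} (hr : Relation.ReflTransGen r u v) :
    Relation.ReflTransGen p u v := by
  induction hr with
  | refl => exact Relation.ReflTransGen.refl
  | tail _ hxy ih => exact ih.tail (h _ _ hxy)

/-- «Blue at `K`» is `BlueAtK`. -/
theorem zone_blueK_iff :
    (G.zoneFZ a b O Z).blueK (G.zoneA a b c O Z) (G.toStZ a b Z x) ↔ G.BlueAtK a b c O Z x := by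
  unfold ZoneData.blueK BlueAtK
  constructor
  · intro h w hw e hj
    rw [← zone_mem_K_iff O x] at hw
    by_contra hSe
    have hSe' : G.extZone a b O Z x e = true := by
      cases h' : G.extZone a b O Z x e
      · exact absurd h' hSe
      · rfl
    have hwZ : w ∈ Z := mem_of_kZone_ext O x ((zone_mem_K_iff O x w).1 hw)
    refine Set.disjoint_left.1 h hw ?_
    rcases hj with hj | hj
    · exact Or.inl ((zone_mem_Blt_iff hc O hZ x w).2 ⟨hwZ, e, hj, hSe'⟩)
    · exact Or.inr ((zone_mem_Mt_iff hc O hZ x w).2 ⟨hwZ, e, hj, hSe'⟩)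
  · intro h
    rw [Set.disjoint_left]
    intro w hw hw'
    rw [zone_mem_K_iff O x] at hw
    rcases hw' with hw' | hw'
    · obtain ⟨_, e, hj, hSe⟩ := (zone_mem_Blt_iff hc O hZ x w).1 hw'
      rw [h w hw e (Or.inl hj)] at hSe
      exact absurd hSe (by decide)
    · obtain ⟨_, e, hj, hSe⟩ := (zone_mem_Mt_iff hc O hZ x w).1 hw'
      rw [h w hw e (Or.inr hj)] at hSe
      exact absurd hSe (by decide)

/-- «Not blue at `K`» is `ValidZone`. -/
theorem zone_validZone_iff :
    ¬ (G.zoneFZ a b O Z).blueK (G.zoneA a b c O Z) (G.toStZ a b Z x) ↔ G.ValidZone a b c O Z x := by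
  rw [zone_blueK_iff hc O hZ x]
  unfold BlueAtK ValidZone
  constructor
  · intro h
    by_contra h'
    apply h
    intro w hw e hj
    by_contra hSe
    have hSe' : G.extZone a b O Z x e = true := by
      cases h'' : G.extZone a b O Z x e
      · exact absurd h'' hSe
      · rfl
    exact h' ⟨w, hw, e, hSe', hj⟩
  · rintro ⟨w, hw, e, hSe, hj⟩ h
    rw [h w hw e hj] at hSe
    exact absurd hSe (by decide)

/-- «Some anchor deleted» is `AnchorDeleted`. -/
theorem zone_anchorDel_iff (hsub : G.BlueSub a b O (G.extZone a b O Z x)) :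
    (G.zoneFZ a b O Z).anchorDel (G.zoneA a b c O Z) (G.toStZ a b Z x) ↔ G.AnchorDeleted a b c O Z x := by
  unfold ZoneData.anchorDel AnchorDeleted
  constructor
  · rintro ⟨w, ⟨hw, hwK⟩, hwD⟩
    exact ⟨w, hw, hwK, (zone_mem_D_iff hc O hZ x hsub hw).1 hwD⟩
  · rintro ⟨w, hw, hwK, hatt⟩
    exact ⟨w, ⟨hw, hwK⟩, (zone_mem_D_iff hc O hZ x hsub hw).2 hatt⟩

/-- For an admissible extension, a vertex of `Z` is outside the blue cluster of `a` iff it is not deleted. -/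
theorem zone_not_mem_cluster_iff (hsub : G.BlueSub a b O (G.extZone a b O Z x))
    (hadm : ¬ G.Conn (G.extZone a b O Z x)ᶜ a b) {v : V} (hv : v ∈ Z) :
    v ∉ G.cluster (G.extZone a b O Z x)ᶜ a ↔ v ∉ (G.zoneFZ a b O Z).D (G.toStZ a b Z x) := by
  rw [mem_cluster_compl_iff_attached a b hadm (ne_terminal_of_mem_idxZone hc hZ hv), zone_mem_D_iff hc O hZ x hsub hv]

/-- `REACH` with the anchors of the zone is `REACH_Z`, for an admissible extension. -/
theorem zone_mem_REACH_iff (hsub : G.BlueSub a b O (G.extZone a b O Z x))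
    (hadm : ¬ G.Conn (G.extZone a b O Z x)ᶜ a b) (v : V) :
    v ∈ (G.zoneFZ a b O Z).REACH (G.zoneA a b c O Z) (G.toStZ a b Z x) ↔
      G.ReachZone a b c O (G.extZone a b O Z x) Z v := by
  unfold ZoneData.REACH ZoneData.reachIn ReachZone
  constructor
  · rintro ⟨s, ⟨⟨hs, hsK⟩, hsD⟩, h⟩
    refine ⟨s, hs, hsK, (zone_not_mem_cluster_iff hc O hZ x hsub hadm hs).2 hsD, ?_⟩
    induction h with
    | refl => exact Relation.ReflTransGen.refl
    | tail hpre hxy ih =>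
      obtain ⟨hxy, _, hyD⟩ := hxy
      have hy : _ ∈ Z := mem_of_redIn_walk hs ((rtg_of_imp (fun _ _ h => (zone_redAdj_iff O x).1 h.1) hpre).tail ((zone_redAdj_iff O x).1 hxy))
      exact ih.tail ⟨(zone_redAdj_iff O x).1 hxy, (zone_not_mem_cluster_iff hc O hZ x hsub hadm hy).2 hyD⟩
  · rintro ⟨s, hs, hsK, hsD, h⟩
    refine ⟨s, ⟨⟨hs, hsK⟩, (zone_not_mem_cluster_iff hc O hZ x hsub hadm hs).1 hsD⟩, ?_⟩
    induction h with
    | refl => exact Relation.ReflTransGen.refl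
    | @tail u w hpre hxy ih =>
      obtain ⟨hxy, hyD⟩ := hxy
      have hx : u ∈ Z := mem_of_redIn_walk hs (rtg_of_imp (fun _ _ h => h.1) hpre)
      have hy : w ∈ Z := mem_of_redIn_walk hx (Relation.ReflTransGen.single hxy)
      have hxD : u ∉ (G.zoneFZ a b O Z).D (G.toStZ a b Z x) := by
        rcases Relation.ReflTransGen.cases_tail hpre with heq | ⟨_, _, hlast⟩
        · rw [heq]
          exact (zone_not_mem_cluster_iff hc O hZ x hsub hadm hs).1 hsD
        · exact (zone_not_mem_cluster_iff hc O hZ x hsub hadm hx).1 hlast.2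
      exact ih.tail ⟨(zone_redAdj_iff O x).2 hxy, hxD, (zone_not_mem_cluster_iff hc O hZ x hsub hadm hy).1 hyD⟩

/-- «No red `2`-edge at `REACH`» is `NoRedTwoReach`. -/
theorem zone_reach2_iff (hsub : G.BlueSub a b O (G.extZone a b O Z x))
    (hadm : ¬ G.Conn (G.extZone a b O Z x)ᶜ a b) :
    (G.zoneFZ a b O Z).reach2 (G.zoneA a b c O Z) (G.toStZ a b Z x) ↔ G.NoRedTwoReach a b c O Z x := by
  unfold ZoneData.reach2 NoRedTwoReach
  constructor
  · intro h w hw e hj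
    rw [← zone_mem_REACH_iff hc O hZ x hsub hadm] at hw
    by_contra hSe
    have hSe' : G.extZone a b O Z x e = true := by
      cases h' : G.extZone a b O Z x e
      · exact absurd h' hSe
      · rfl
    have hwZ : w ∈ Z := by
      obtain ⟨s, hs, _, _, hsw⟩ := (zone_mem_REACH_iff hc O hZ x hsub hadm w).1 hw
      exact mem_of_redIn_walk hs (rtg_of_imp (fun _ _ h => h.1) hsw)
    exact Set.disjoint_left.1 h hw ((zone_mem_Mt_iff hc O hZ x w).2 ⟨hwZ, e, hj, hSe'⟩)
  · intro h
    rw [Set.disjoint_left]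
    intro w hw hw'
    rw [zone_mem_REACH_iff hc O hZ x hsub hadm] at hw
    obtain ⟨_, e, hj, hSe⟩ := (zone_mem_Mt_iff hc O hZ x w).1 hw'
    rw [h w hw e hj] at hSe
    exact absurd hSe (by decide)

end Dict

section Count

variable [Fintype V] [Fintype E] [DecidableEq E] (hc : c ≠ a ∧ c ≠ b) (hne : a ≠ b) (O : Config E) {Z : Finset V}
  (hZ : G.IsIdxZone a b c O Z)

include hc hne hZ

open Classical

omit hne in
/-- `𝓛_Z` of the tree injects into `LsetF` of the abstract zone. -/
theorem card_Lset_le_card_LsetF :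
    (G.Lset a b c O Z).card ≤ ((G.zoneFZ a b O Z).LsetF (zoneQ c Z) (G.zoneA a b c O Z)).card := by
  refine Finset.card_le_card_of_injOn (G.toStZ a b Z) ?_ fun x _ x' _ h => toStZ_injective Z h
  intro x hx
  rw [Finset.mem_coe] at hx
  unfold Lset at hx
  rw [Finset.mem_filter] at hx
  obtain ⟨_, hadmZ, hK, hdel⟩ := hx
  rw [Finset.mem_coe, FZone.mem_LsetF]
  obtain ⟨hF, hA, hG⟩ := (zone_admZone_iff hc O hZ x).1 hadmZ
  have hsub := blueSub_extZone_of_chords hadmZ.1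
  exact ⟨hF, hA, (zone_blueK_iff hc O hZ x).2 hK, (zone_anchorDel_iff hc O hZ x hsub).2 hdel, hG⟩

/-- `RsetF` of the abstract zone injects into `𝓡_Z` of the tree. -/
theorem card_RsetF_le_card_Rset :
    ((G.zoneFZ a b O Z).RsetF (zoneQ c Z) (G.zoneA a b c O Z)).card ≤ (G.Rset a b c O Z).card := by
  have hZnt : ∀ v ∈ Z, v ≠ a ∧ v ≠ b := fun v hv => ne_terminal_of_mem_idxZone hc hZ hv
  refine Finset.card_le_card_of_injOn (G.ofStZ a b Z) ?_ fun σ _ σ' _ h => ofStZ_injective hne hZnt h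
  intro σ hσ
  rw [Finset.mem_coe, FZone.mem_RsetF] at hσ
  rw [Finset.mem_coe]
  unfold Rset
  rw [Finset.mem_filter]
  set x := G.ofStZ a b Z σ with hxdef
  have hσx : G.toStZ a b Z x = σ := toStZ_ofStZ hne hZnt σ
  rw [← hσx] at hσ
  obtain ⟨hF, hA, hnd, h2, hK, hG⟩ := hσ
  have hadmZ : G.AdmZone a b c O Z x := (zone_admZone_iff hc O hZ x).2 ⟨hF, hA, hG⟩
  have hsub := blueSub_extZone_of_chords hadmZ.1
  have hadm : ¬ G.Conn (G.extZone a b O Z x)ᶜ a b := (adm_extZone hc hne hZ hadmZ).2.2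
  refine ⟨Finset.mem_univ _, hadmZ, ?_, (zone_reach2_iff hc O hZ x hsub hadm).1 h2,
    (zone_validZone_iff hc O hZ x).1 hK⟩
  intro hdel
  exact hnd ((zone_anchorDel_iff hc O hZ x hsub).2 hdel)

/-- **THE ZONE LEMMA ON AN INDEXED ZONE**: `#𝓛_Z ≤ #𝓡_Z`, by THEOREM Z′ on the zone with forced edges. -/
theorem card_Lset_le_card_Rset_zone : (G.Lset a b c O Z).card ≤ (G.Rset a b c O Z).card :=
  (card_Lset_le_card_LsetF hc O hZ).trans
    (((G.zoneFZ a b O Z).card_LsetF_le_card_RsetF (zoneQ c Z) (G.zoneA a b c O Z)).trans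
      (card_RsetF_le_card_Rset hc hne O hZ))

end Count

section Named

variable [Fintype V] [Fintype E] [DecidableEq E]

open Classical

/-- **mine-3's ZONE LEMMA HOLDS** (`ZoneLemma a b c` of `C041ZoneLemmaConj`): for every bare colouring `O` and every
indexed zone `Z` of `O`, `#𝓛_Z ≤ #𝓡_Z` — for every skeleton with `c` a non-terminal and distinct terminals. -/
theorem zoneLemma_holds (hc : c ≠ a ∧ c ≠ b) (hne : a ≠ b) : G.ZoneLemma a b c :=
  fun O Z => card_Lset_le_card_Rset_zone hc hne O Z.2

/-- (INV) on the tail-free colourings a second way: through the REDUCTION THEOREM of gen 26 and the ZONE LEMMA on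
both sides. -/
theorem INVConjTailFree_holds (hc : c ≠ a ∧ c ≠ b) (hne : a ≠ b) (hab : ∃ e, G.Joins e a b) :
    G.INVConjTailFree a b c :=
  INVConjTailFree_of_zoneLemma hc hne hab (zoneLemma_holds hc hne) (zoneLemma_holds ⟨hc.2, hc.1⟩ hne.symm)

end Named

end MultiGraph

end PercRepro
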